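import Mathlib
import Summits.Ventures.PercRepro2.OStarModel

/-!
# The gluing model of the star of `o` with the slots `a₃, a₁, b` (blind cell PercRepro2, mine-2
g39, 2026-08-28; `proofs/MINE2-GLUE.md` §7, row M2-83)

The star of `o` read with the slot order `(o–a₃, o–a₁, o–b)`: the rest's pattern `P` lives on the
marks in the order `a₃, a₁, a₂, b` (index `0` is `a₃`, `1` is `a₁`, `2` is `a₂`, `3` is `b`), the
open-neighbour set `N = (o–a₃, o–a₁, o–b)`, and the glued state `S3 P N` is assembled
accordingly.  `PSYM3`, `C3` as before.  The family of the theorem is `N(o) ⊆ {a₃, b}` — the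
middle slot absent (`t₂ = 0`): with the edge `o–a₁` typed `2` the gadget sums change sign
(typings `(1, 2, 2)` and `(2, 2, 1)`, `proofs/MINE2-GADGET.md` §7), so only the typings with
`t₂ = 0` are certified (`A3BStarCert.lean`).  `C3` is symmetric in the patterns (`C3_swap12`,
`C3_swap23`, `C3_perm`) and vanishes when a pattern joins the roots — in this order the marks `1, 2`, the fourth bit
(`C3_eq_zero_of_p12`; the `Q`-patterns are `validQ3`).  Own
code; standard axioms.
-/

namespace Summit.Ventures.PercRepro2

namespace CovForm

namespace OStar

open OneTyped Untouched

/-- The glued state of the `o`-star with the slots `a₃, a₁, b`: `(q′, L_o, H_o, L_b, H_b, L₃, H₃)`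
with the pattern's marks `0 = a₃, 1 = a₁, 2 = a₂, 3 = b`. -/
def S3 (P : Pat) (N : Nb) : St :=
  (connG P N 2 1, reach P N 1, reach P N 2, connG P N 1 3, connG P N 2 3, connG P N 1 0,
    connG P N 2 0)

/-- The kernel on the glued `S3`-states, symmetrised over the three patterns. -/
def PSYM3 (N₁ N₂ N₃ : Nb) (P₁ P₂ P₃ : Pat) : ℤ :=
  KB (S3 P₁ N₁) (S3 P₂ N₂) (S3 P₃ N₃) + KB (S3 P₁ N₁) (S3 P₃ N₂) (S3 P₂ N₃) +
    KB (S3 P₂ N₁) (S3 P₁ N₂) (S3 P₃ N₃) + KB (S3 P₂ N₁) (S3 P₃ N₂) (S3 P₁ N₃) +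
    KB (S3 P₃ N₁) (S3 P₁ N₂) (S3 P₂ N₃) + KB (S3 P₃ N₁) (S3 P₂ N₂) (S3 P₁ N₃)

/-- The gadget sum of the `o`-star with the slots `a₃, a₁, b` for the typing `(t₁, t₂, t_b)` on a pattern triple. -/
def C3 (t₁ t₂ tO : ℕ) (P₁ P₂ P₃ : Pat) : ℤ :=
  ((plc t₁).map fun c₁ => ((plc t₂).map fun c₂ => ((plc tO).map fun cO =>
    PSYM3 (c₁.1, c₂.1, cO.1) (c₁.2.1, c₂.2.1, cO.2.1) (c₁.2.2, c₂.2.2, cO.2.2) P₁ P₂ P₃).sum).sum).sum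

/-- `PSYM3` is symmetric in its first two patterns. -/
lemma PSYM3_swap12 (N₁ N₂ N₃ : Nb) (P₁ P₂ P₃ : Pat) :
    PSYM3 N₁ N₂ N₃ P₂ P₁ P₃ = PSYM3 N₁ N₂ N₃ P₁ P₂ P₃ := by
  unfold PSYM3; ring

/-- `PSYM3` is symmetric in its last two patterns. -/
lemma PSYM3_swap23 (N₁ N₂ N₃ : Nb) (P₁ P₂ P₃ : Pat) :
    PSYM3 N₁ N₂ N₃ P₁ P₃ P₂ = PSYM3 N₁ N₂ N₃ P₁ P₂ P₃ := by
  unfold PSYM3; ring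

/-- The `a₃b`-gadget sum is symmetric in its first two patterns. -/
lemma C3_swap12 (t₁ t₂ tO : ℕ) (P₁ P₂ P₃ : Pat) : C3 t₁ t₂ tO P₂ P₁ P₃ = C3 t₁ t₂ tO P₁ P₂ P₃ := by
  unfold C3; simp only [PSYM3_swap12]

/-- The `a₃b`-gadget sum is symmetric in its last two patterns. -/
lemma C3_swap23 (t₁ t₂ tO : ℕ) (P₁ P₂ P₃ : Pat) : C3 t₁ t₂ tO P₁ P₃ P₂ = C3 t₁ t₂ tO P₁ P₂ P₃ := by
  unfold C3; simp only [PSYM3_swap23]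

/-- Any permutation of the patterns, from the two swaps. -/
lemma C3_perm (t₁ t₂ tO : ℕ) (P₁ P₂ P₃ : Pat) :
    C3 t₁ t₂ tO P₁ P₂ P₃ = C3 t₁ t₂ tO P₂ P₁ P₃ ∧ C3 t₁ t₂ tO P₁ P₂ P₃ = C3 t₁ t₂ tO P₁ P₃ P₂ ∧
      C3 t₁ t₂ tO P₁ P₂ P₃ = C3 t₁ t₂ tO P₂ P₃ P₁ ∧ C3 t₁ t₂ tO P₁ P₂ P₃ = C3 t₁ t₂ tO P₃ P₁ P₂ ∧
      C3 t₁ t₂ tO P₁ P₂ P₃ = C3 t₁ t₂ tO P₃ P₂ P₁ := by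
  refine ⟨(C3_swap12 ..).symm, (C3_swap23 ..).symm, ?_, ?_, ?_⟩
  · rw [C3_swap23 t₁ t₂ tO P₂ P₁ P₃, C3_swap12 t₁ t₂ tO P₁ P₂ P₃]
  · rw [← C3_swap12 t₁ t₂ tO P₃ P₁ P₂, C3_swap23 t₁ t₂ tO P₁ P₂ P₃]
  · rw [← C3_swap12 t₁ t₂ tO P₃ P₂ P₁, C3_swap23 t₁ t₂ tO P₂ P₁ P₃, C3_swap12 t₁ t₂ tO P₁ P₂ P₃]

/-- A `Q`-pattern in the order `a₃, a₁, a₂, b`: a set partition not joining the roots — the roots are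
the marks `1, 2`, their bit is the fourth. -/
def validQ3 (P : Pat) : Bool := valid P && !P.2.2.2.1

/-- The glued `S3`-state of a pattern joining the roots (the fourth bit, marks `1, 2`) fails `Q`. -/
lemma S3_q'_of_p12 {P : Pat} (h : P.2.2.2.1 = true) (N : Nb) : (S3 P N).q' = true := by
  simp [S3, St.q', connG, connP, h]

/-- `PSYM3` vanishes when one of the patterns joins the roots (the fourth bit). -/
lemma PSYM3_eq_zero_of_p12 (N₁ N₂ N₃ : Nb) {P₁ P₂ P₃ : Pat}
    (h : P₁.2.2.2.1 = true ∨ P₂.2.2.2.1 = true ∨ P₃.2.2.2.1 = true) :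
    PSYM3 N₁ N₂ N₃ P₁ P₂ P₃ = 0 := by
  unfold PSYM3
  rcases h with h | h | h
  · rw [KB_eq_zero_of_q' _ _ _ (Or.inl (S3_q'_of_p12 h N₁)),
      KB_eq_zero_of_q' _ _ _ (Or.inl (S3_q'_of_p12 h N₁)),
      KB_eq_zero_of_q' _ _ _ (Or.inr (Or.inl (S3_q'_of_p12 h N₂))),
      KB_eq_zero_of_q' _ _ _ (Or.inr (Or.inr (S3_q'_of_p12 h N₃))),
      KB_eq_zero_of_q' _ _ _ (Or.inr (Or.inl (S3_q'_of_p12 h N₂))),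
      KB_eq_zero_of_q' _ _ _ (Or.inr (Or.inr (S3_q'_of_p12 h N₃)))]
    ring
  · rw [KB_eq_zero_of_q' _ _ _ (Or.inr (Or.inl (S3_q'_of_p12 h N₂))),
      KB_eq_zero_of_q' _ _ _ (Or.inr (Or.inr (S3_q'_of_p12 h N₃))),
      KB_eq_zero_of_q' _ _ _ (Or.inl (S3_q'_of_p12 h N₁)),
      KB_eq_zero_of_q' _ _ _ (Or.inl (S3_q'_of_p12 h N₁)),
      KB_eq_zero_of_q' _ _ _ (Or.inr (Or.inr (S3_q'_of_p12 h N₃))),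
      KB_eq_zero_of_q' _ _ _ (Or.inr (Or.inl (S3_q'_of_p12 h N₂)))]
    ring
  · rw [KB_eq_zero_of_q' _ _ _ (Or.inr (Or.inr (S3_q'_of_p12 h N₃))),
      KB_eq_zero_of_q' _ _ _ (Or.inr (Or.inl (S3_q'_of_p12 h N₂))),
      KB_eq_zero_of_q' _ _ _ (Or.inr (Or.inr (S3_q'_of_p12 h N₃))),
      KB_eq_zero_of_q' _ _ _ (Or.inr (Or.inl (S3_q'_of_p12 h N₂))),
      KB_eq_zero_of_q' _ _ _ (Or.inl (S3_q'_of_p12 h N₁)),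
      KB_eq_zero_of_q' _ _ _ (Or.inl (S3_q'_of_p12 h N₁))]
    ring

/-- The `a₃b`-gadget sum vanishes when one of the patterns joins the roots (the fourth bit). -/
lemma C3_eq_zero_of_p12 (t₁ t₂ tO : ℕ) {P₁ P₂ P₃ : Pat}
    (h : P₁.2.2.2.1 = true ∨ P₂.2.2.2.1 = true ∨ P₃.2.2.2.1 = true) :
    C3 t₁ t₂ tO P₁ P₂ P₃ = 0 := by
  unfold C3
  simp only [PSYM3_eq_zero_of_p12 _ _ _ h, List.map_const', List.sum_replicate, smul_zero]

end OStar

end CovForm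

end Summit.Ventures.PercRepro2
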